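import Mathlib
import Summits.Ventures.PercRepro2.Defs
import Summits.Ventures.PercRepro2.Independence
import Summits.Ventures.PercRepro2.Harris
import Summits.Ventures.PercRepro2.Graph
import Summits.Ventures.PercRepro2.Exploration
import Summits.Ventures.PercRepro2.Events
import Summits.Ventures.PercRepro2.FourFunctions
import Summits.Ventures.PercRepro2.Induced
import Summits.Ventures.PercRepro2.Frontier
import Summits.Ventures.PercRepro2.ObsIndependence
import Summits.Ventures.PercRepro2.BHK
import Summits.Ventures.PercRepro2.BHKEvents
import Summits.Ventures.PercRepro2.SideAgreement
import Summits.Ventures.PercRepro2.VdBKahn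
import Summits.Ventures.PercRepro2.BHKAvoid
import Summits.Ventures.PercRepro2.R2PrimeThreeReduction
import Summits.Ventures.PercRepro2.YBridge
import Summits.Ventures.PercRepro2.Yu1Functionals
import Summits.Ventures.PercRepro2.Yu1Events
import Summits.Ventures.PercRepro2.Yu1
import Summits.Ventures.PercRepro2.LBSplit
import Summits.Ventures.PercRepro2.YDelta
import Summits.Ventures.PercRepro2.SD
import Summits.Ventures.PercRepro2.Threshold
import Summits.Ventures.PercRepro2.Lambda
import Summits.Ventures.PercRepro2.LambdaTau
import Summits.Ventures.PercRepro2.LambdaSlack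
import Summits.Ventures.PercRepro2.HF2
import Summits.Ventures.PercRepro2.Yu2
import Summits.Ventures.PercRepro2.N0
import Summits.Ventures.PercRepro2.Y
import Summits.Ventures.PercRepro2.YDeltaTools
import Summits.Ventures.PercRepro2.ZDelta
import Summits.Ventures.PercRepro2.ZExpand
import Summits.Ventures.PercRepro2.ISplit
import Summits.Ventures.PercRepro2.MRl
import Summits.Ventures.PercRepro2.ZOloc
import Summits.Ventures.PercRepro2.SideBridge
import Summits.Ventures.PercRepro2.HCov
import Summits.Ventures.PercRepro2.HCovFns
import Summits.Ventures.PercRepro2.HCovSwap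
import Summits.Ventures.PercRepro2.BasePrime
import Summits.Ventures.PercRepro2.PendantRoot
import Summits.Ventures.PercRepro2.PendantO
import Summits.Ventures.PercRepro2.PendantB
import Summits.Ventures.PercRepro2.PendantBRow

/-!
# The LEAF STEP of (HCOV) at an unmarked attachment vertex (blind cell PercRepro2, p1 g7;
lead g11 ask 2026-08-23T11:39:01Z (1), ADDENDUM 25 (47); `proofs/P1-LEAFSTEP.md`)

Let `a₃` be a leaf attached by the edge `f` (weight `q = p f`) to a vertex `v ∉ {o, b, a₁, a₂}`.
Every `a₃`-event is "`f` open ∧ the same event for `v`", so `Gc` is a QUADRATIC in `q` whose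
coefficients are polynomials in the `Q`-masses of the `v`-marked configuration, and in the
Bernstein basis

  **`Gc p o a₁ a₂ a₃ b = (1 − q)² · T₀ + 2q(1 − q) · R½ + q² · Gc p o a₁ a₂ v b`**   (`Gc_leaf`)

with `T₀` the `a₃`-free functional (the theorem `2P(Z_L + Z_H)`), `Gc p o a₁ a₂ v b` the same
functional with the marker `v` (i.e. (HCOV) on `G − a₃` at `a₃ := v`), and the middle coefficient
`R½ = T₀ + ½·Gc′` (`Rhalf`; closed form `P1-LEAFSTEP.md` §1, checked against the 5,115-monomial
expansion). Hence (`HCov_leaf_of`) (HCOV) at the leaf follows from (HCOV) at the marker `v` and the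
row **`LeafRow := 0 ≤ R½`** — the first induction step of the weighted line: (HCOV) on all graphs
reduces to graphs in which `a₃` has no leaf attachment at an unmarked vertex, modulo `LeafRow`
(census 0 / 7,560 at `n = 5`, own exact code).
-/

namespace Summit.Ventures.PercRepro2

open UnionCluster CovForm PendantRoot PendantO

namespace LeafStep

variable {V : Type*} {E : Type*} [Fintype E] [DecidableEq E] [Fintype V] [DecidableEq V]
  {R : Type*} [Field R] [LinearOrder R] [IsStrictOrderedRing R]

section Defs

variable (p : E → R) (ends : E → Sym2 V)

/-- `P(Q, x ∈ U) = P(Q, x ∈ C₁) + P(Q, x ∈ C₂)`. -/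
noncomputable def mU (a₁ a₂ x : V) : R :=
  prob p (avoidAll ends a₂ {a₁} ∩ connEvent ends a₁ x) +
    prob p (avoidAll ends a₂ {a₁} ∩ connEvent ends a₂ x)

/-- `P(Q, o ∈ U, b ∈ U)` (the four cluster patterns). -/
noncomputable def mUU (o a₁ a₂ b : V) : R :=
  prob p (avoidAll ends a₂ {a₁} ∩ (connEvent ends a₁ o ∩ connEvent ends a₁ b)) +
    prob p (avoidAll ends a₂ {a₁} ∩ (connEvent ends a₂ o ∩ connEvent ends a₂ b)) +
    prob p (avoidAll ends a₂ {a₁} ∩ (connEvent ends a₂ o ∩ connEvent ends a₁ b)) +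
    prob p (avoidAll ends a₂ {a₁} ∩ (connEvent ends a₁ o ∩ connEvent ends a₂ b))

/-- **`T₀`**, the `a₃`-free functional: `P²·E_Q[σ_bσ_o] + gap·P·E_Q[σ_o] + P·(mo·mb − P·Sig)`
(`= 2P(Z_L + Z_H)`, the theorem `R(0)`). -/
noncomputable def T0 (o a₁ a₂ b : V) : R :=
  prob p (avoidAll ends a₂ {a₁}) ^ 2 * EQbo p ends o a₁ a₂ b +
    gap p ends a₁ a₂ b * prob p (avoidAll ends a₂ {a₁}) * EQo p ends o a₁ a₂ +
    prob p (avoidAll ends a₂ {a₁}) *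
      (mU p ends a₁ a₂ o * mU p ends a₁ a₂ b - prob p (avoidAll ends a₂ {a₁}) * mUU p ends o a₁ a₂ b)

/-- **`Gc′`**, the first-order coefficient of the leaf expansion (closed form of
`P1-LEAFSTEP.md` §1; the `v`-moments are the `HCov` building blocks at the marker `v`). -/
noncomputable def Gc1 (o a₁ a₂ v b : V) : R :=
  prob p (avoidAll ends a₂ {a₁}) *
      (-(mU p ends a₁ a₂ v) * EQbo p ends o a₁ a₂ b + mU p ends a₁ a₂ o * EQb3 p ends a₁ a₂ v b -
        prob p (avoidAll ends a₂ {a₁}) * EQb3o p ends o a₁ a₂ v b) +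
    gap p ends a₁ a₂ b *
      (-(mU p ends a₁ a₂ v) * EQo p ends o a₁ a₂ + mU p ends a₁ a₂ o * EQ3 p ends a₁ a₂ v -
        prob p (avoidAll ends a₂ {a₁}) * EQ3o p ends o a₁ a₂ v) +
    prob p (avoidAll ends a₂ {a₁}) *
      (-(mU p ends a₁ a₂ o - Do p ends o a₁ a₂ v) * mU p ends a₁ a₂ b -
        mU p ends a₁ a₂ o * (mU p ends a₁ a₂ b - PDb p ends a₁ a₂ v b) +
        mU p ends a₁ a₂ v * mUU p ends o a₁ a₂ b +
        prob p (avoidAll ends a₂ {a₁}) * (mUU p ends o a₁ a₂ b - PDbo p ends o a₁ a₂ v b))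

/-- **`R½ = T₀ + ½·Gc′`**, the middle Bernstein coefficient of the leaf expansion. -/
noncomputable def Rhalf (o a₁ a₂ v b : V) : R :=
  T0 p ends o a₁ a₂ b + Gc1 p ends o a₁ a₂ v b / 2

/-- **Row (LEAF)**: `0 ≤ R½` — the new content of the leaf step at the attachment vertex `v`. -/
def LeafRow (o a₁ a₂ v b : V) : Prop := 0 ≤ Rhalf p ends o a₁ a₂ v b

end Defs

/-! ## The `v`-marked atoms of `Gc p o a₁ a₂ v b` -/

section Atoms

variable (p : E → R) (ends : E → Sym2 V)

omit [Fintype V] [DecidableEq V] [LinearOrder R] [IsStrictOrderedRing R] in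
/-- `P(T_v ∩ X) = P(Q ∩ ({v ∈ C₂} ∩ X))`. -/
lemma prob_T_inter_v (a₁ a₂ v : V) (X : Set (Config E)) :
    prob p (TEvent ends a₁ a₂ v ∩ X) =
      prob p (avoidAll ends a₂ {a₁} ∩ (connEvent ends a₂ v ∩ X)) := by
  rw [T_eq_Q_inter, Set.inter_assoc]

omit [Fintype V] [DecidableEq V] [LinearOrder R] [IsStrictOrderedRing R] in
/-- `P(T′_v ∩ X) = P(Q ∩ ({v ∈ C₁} ∩ X))`. -/
lemma prob_T'_inter_v (a₁ a₂ v : V) (X : Set (Config E)) :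
    prob p (TEvent ends a₂ a₁ v ∩ X) =
      prob p (avoidAll ends a₂ {a₁} ∩ (connEvent ends a₁ v ∩ X)) := by
  rw [T_eq_Q_inter, avoidAll_root_swap, Set.inter_assoc]

omit [Fintype V] in
/-- `P(PD_v ∩ X) = P(Q ∩ X) − P(Q ∩ ({v ∈ C₁} ∩ X)) − P(Q ∩ ({v ∈ C₂} ∩ X))`. -/
lemma prob_PD_inter_v (a₁ a₂ v : V) (X : Set (Config E)) :
    prob p (PDEvent ends a₁ a₂ v ∩ X) =
      prob p (avoidAll ends a₂ {a₁} ∩ X) -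
        prob p (avoidAll ends a₂ {a₁} ∩ (connEvent ends a₁ v ∩ X)) -
        prob p (avoidAll ends a₂ {a₁} ∩ (connEvent ends a₂ v ∩ X)) := by
  have h := Qsplit p ends a₁ a₂ v X
  rw [prob_T_inter_v, prob_T'_inter_v] at h
  linarith

omit [Fintype V] [DecidableEq V] [LinearOrder R] [IsStrictOrderedRing R] in
/-- `P(T_v) = P(Q ∩ {v ∈ C₂})`. -/
lemma prob_T_v (a₁ a₂ v : V) :
    prob p (TEvent ends a₁ a₂ v) = prob p (avoidAll ends a₂ {a₁} ∩ connEvent ends a₂ v) := by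
  rw [T_eq_Q_inter]

omit [Fintype V] [DecidableEq V] [LinearOrder R] [IsStrictOrderedRing R] in
/-- `P(T′_v) = P(Q ∩ {v ∈ C₁})`. -/
lemma prob_T'_v (a₁ a₂ v : V) :
    prob p (TEvent ends a₂ a₁ v) = prob p (avoidAll ends a₂ {a₁} ∩ connEvent ends a₁ v) := by
  rw [T_eq_Q_inter, avoidAll_root_swap]

omit [Fintype V] in
/-- `P(PD_v) = P(Q) − P(Q ∩ {v ∈ C₁}) − P(Q ∩ {v ∈ C₂})`. -/
lemma prob_PD_v (a₁ a₂ v : V) :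
    prob p (PDEvent ends a₁ a₂ v) =
      prob p (avoidAll ends a₂ {a₁}) - prob p (avoidAll ends a₂ {a₁} ∩ connEvent ends a₁ v) -
        prob p (avoidAll ends a₂ {a₁} ∩ connEvent ends a₂ v) := by
  have h := Qsplit_univ p ends a₁ a₂ v
  rw [prob_T_v, prob_T'_v] at h
  linarith

end Atoms

/-! ## The identity and the leaf step -/

section Main

variable (p : E → R) (ends : E → Sym2 V)

omit [Fintype V] in
/-- **The leaf expansion in the Bernstein basis**: for `a₃` a leaf at `v ∉ {o, b, a₁, a₂}` through
`f` with `q = p f`, `Gc p o a₁ a₂ a₃ b = (1 − q)² T₀ + 2q(1 − q) R½ + q² · Gc p o a₁ a₂ v b`. -/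
theorem Gc_leaf {f : E} {a₃ v : V} (hf : ends f = s(a₃, v)) (hleaf : ∀ e, a₃ ∈ ends e → e = f)
    (h3v : a₃ ≠ v) {o a₁ a₂ b : V} (h31 : a₃ ≠ a₁) (h32 : a₃ ≠ a₂) (ho : o ≠ a₃) (hb : b ≠ a₃) :
    Gc p ends o a₁ a₂ a₃ b =
      (1 - p f) ^ 2 * T0 p ends o a₁ a₂ b +
        2 * p f * (1 - p f) * Rhalf p ends o a₁ a₂ v b +
        p f ^ 2 * Gc p ends o a₁ a₂ v b := by
  have c₁o := free_connEvent hf hleaf h3v (Ne.symm h31) ho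
  have c₂o := free_connEvent hf hleaf h3v (Ne.symm h32) ho
  have c₁b := free_connEvent hf hleaf h3v (Ne.symm h31) hb
  have c₂b := free_connEvent hf hleaf h3v (Ne.symm h32) hb
  unfold Rhalf T0 Gc1 mU mUU
  unfold Gc DEF EQbo EQb3 EQb3o EQo EQ3 EQ3o PDb PDbo Do
  rw [gap_eq_Q]
  simp only [prob_PD_o p hf hleaf h3v h31 h32, prob_T_o p hf hleaf h3v h31 h32,
    prob_T'_o p hf hleaf h3v h31 h32,
    prob_PD_inter_o p hf hleaf h3v h31 h32 c₁b, prob_PD_inter_o p hf hleaf h3v h31 h32 c₂b,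
    prob_PD_inter_o p hf hleaf h3v h31 h32 c₁o, prob_PD_inter_o p hf hleaf h3v h31 h32 c₂o,
    prob_PD_inter_o p hf hleaf h3v h31 h32 (c₁o.inter c₁b),
    prob_PD_inter_o p hf hleaf h3v h31 h32 (c₂o.inter c₁b),
    prob_PD_inter_o p hf hleaf h3v h31 h32 (c₁o.inter c₂b),
    prob_PD_inter_o p hf hleaf h3v h31 h32 (c₂o.inter c₂b),
    prob_T_inter_o p hf hleaf h3v h31 h32 c₁b, prob_T_inter_o p hf hleaf h3v h31 h32 c₂b,
    prob_T_inter_o p hf hleaf h3v h31 h32 c₁o, prob_T_inter_o p hf hleaf h3v h31 h32 c₂o,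
    prob_T_inter_o p hf hleaf h3v h31 h32 (c₁o.inter c₁b),
    prob_T_inter_o p hf hleaf h3v h31 h32 (c₂o.inter c₁b),
    prob_T_inter_o p hf hleaf h3v h31 h32 (c₁o.inter c₂b),
    prob_T_inter_o p hf hleaf h3v h31 h32 (c₂o.inter c₂b),
    prob_T'_inter_o p hf hleaf h3v h31 h32 c₁b, prob_T'_inter_o p hf hleaf h3v h31 h32 c₂b,
    prob_T'_inter_o p hf hleaf h3v h31 h32 c₁o, prob_T'_inter_o p hf hleaf h3v h31 h32 c₂o,
    prob_T'_inter_o p hf hleaf h3v h31 h32 (c₁o.inter c₁b),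
    prob_T'_inter_o p hf hleaf h3v h31 h32 (c₂o.inter c₁b),
    prob_T'_inter_o p hf hleaf h3v h31 h32 (c₁o.inter c₂b),
    prob_T'_inter_o p hf hleaf h3v h31 h32 (c₂o.inter c₂b),
    prob_PD_v p ends a₁ a₂ v, prob_T_v p ends a₁ a₂ v, prob_T'_v p ends a₁ a₂ v,
    prob_PD_inter_v p ends a₁ a₂ v, prob_T_inter_v p ends a₁ a₂ v, prob_T'_inter_v p ends a₁ a₂ v]
  ring

omit [Fintype V] in
/-- **THE LEAF STEP**: (HCOV) at the marker `v` and the row `0 ≤ R½` give (HCOV) at a leaf `a₃`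
attached to `v`. -/
theorem HCov_leaf_of (hp : IsProbVec p) {f : E} {a₃ v : V} (hf : ends f = s(a₃, v))
    (hleaf : ∀ e, a₃ ∈ ends e → e = f) (h3v : a₃ ≠ v) {o a₁ a₂ b : V} (h31 : a₃ ≠ a₁)
    (h32 : a₃ ≠ a₂) (ho : o ≠ a₃) (hb : b ≠ a₃) (hv : HCov p ends o a₁ a₂ v b)
    (hrow : LeafRow p ends o a₁ a₂ v b) (hT0 : 0 ≤ T0 p ends o a₁ a₂ b) :
    HCov p ends o a₁ a₂ a₃ b := by
  unfold HCov
  rw [Gc_leaf p ends hf hleaf h3v h31 h32 ho hb]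
  have hq0 := hp.nonneg f
  have hq1 := hp.le_one f
  have h1q : 0 ≤ 1 - p f := sub_nonneg.2 hq1
  unfold LeafRow at hrow
  unfold HCov at hv
  have t0 : 0 ≤ (1 - p f) ^ 2 := sq_nonneg _
  have t1 : 0 ≤ 2 * p f * (1 - p f) := mul_nonneg (mul_nonneg (by norm_num) hq0) h1q
  have t2 : 0 ≤ p f ^ 2 := sq_nonneg _
  exact add_nonneg (add_nonneg (mul_nonneg t0 hT0) (mul_nonneg t1 hrow)) (mul_nonneg t2 hv)

end Main

end LeafStep

end Summit.Ventures.PercRepro2
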